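import Summits.BirchSwinnertonDyer.BirchSwinnertonDyer.Theses.AdditiveKolyvaginRoad

/-!
# Sketch — crux idea `central-companion-transport` (stmt-BirchSwinnertonDyer-21400, r1 seat 1 g20)

BSD is not proved by this.  First checkable statements of the line:

* the BRANCH ARITHMETIC of a one-slope additive potentially-supersingular class `(p, e, a′)`:
  `E[p]|I_p ≃ ψ₂^n ⊕ ψ₂^{pn}`, `n = 1 + a′(p²−1)/e`; Fouquet–Wan normal form `(a, b)`, `a < b`, of the pair
  `{n, pn} mod (p² − 1)` written in base `p`; the p-GOOD companion `h″` with `ρ̄_{h″} ≃ E[p] ⊗ ω^a` has weight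
  `2a + 2` and enters `X_Σ(E[p])` on its CENTRAL Teichmüller branch (`(2a+2) − 1 − a = (2a+2)/2`).
  `CompanionCentralShort`: for `p ≥ 7` every class has `1 ≤ a ≤ (p−3)/2`, i.e. companion weight in `[4, p−1]`
  (short crystalline, never weight 2, never the quadratic branch); decided below at `p = 7, 11, 23` and the
  two `p = 5` exceptions (`II*`: `a = 0`, weight 2; `IV`: `a = 2 = (p−1)/2`, quadratic branch) are exhibited.
* the transported LOCUS predicate `CentralCompanionAnchorLocus W p a` (the anchor theorem's Steinberg-prime
  hypothesis read on `E`: `a_ℓ(E) · ℓ^{a+1} ≢ 1 (mod p)` at a multiplicative `ℓ` with `p ∤ v_ℓ(Δ_min)`).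
-/

namespace Summit.BirchSwinnertonDyer.BirchSwinnertonDyer.Cruxes.KolyvaginPrimitiveAdditive.CentralCompanionTransport

/-- Fouquet–Wan normal-form exponent `a` of the inertial pair `{n, pn} (mod p²−1)`: write `m = b + p·a`
(`a = m / p`, `b = m % p`); the normal form is the member of the pair with `a < b`. -/
def fwNormalExponent (p n : ℕ) : ℕ :=
  let N := p ^ 2 - 1
  let m₁ := n % N
  let m₂ := (p * n) % N
  if m₁ / p < m₁ % p then m₁ / p else m₂ / p

/-- The tame exponent `n = 1 + a′·(p²−1)/e` of the class `(p, e, a′)`. -/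
def classIndex (p e a' : ℕ) : ℕ := 1 + a' * ((p ^ 2 - 1) / e)

/-- The class exponent `a = a(p, e, a′)`; the p-good companion has weight `2a + 2`. -/
def classExponent (p e a' : ℕ) : ℕ := fwNormalExponent p (classIndex p e a')

/-- FIRST LEMMA (`CompanionCentralShort`).  For `p ≥ 7`, `e ∈ {3,4,6}`, `e ∣ p+1`, `e ∤ p−1`, `a′` a unit
mod `e`: `1 ≤ a` and `2a + 3 ≤ p` — the companion weight `2a+2` lies in `[4, p−1]`. -/
def CompanionCentralShort : Prop :=
  ∀ p e a' : ℕ, p.Prime → 7 ≤ p → (e = 3 ∨ e = 4 ∨ e = 6) → e ∣ p + 1 → ¬ e ∣ p - 1 →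
    a' < e → Nat.Coprime a' e →
    1 ≤ classExponent p e a' ∧ 2 * classExponent p e a' + 3 ≤ p

/-- toy rung: `p = 7` (`e = 4`, Kodaira III / III*): exponents `1, 2`, companion weights `4, 6`. -/
example : classExponent 7 4 1 = 1 ∧ classExponent 7 4 3 = 2 := by decide

example : ∀ a' < 4, Nat.Coprime a' 4 →
    1 ≤ classExponent 7 4 a' ∧ 2 * classExponent 7 4 a' + 3 ≤ 7 := by decide

/-- toy rung: `p = 11` (`e = 3, 4, 6`): all six classes have `1 ≤ a ≤ 4`. -/
example : (∀ a' < 3, Nat.Coprime a' 3 → 1 ≤ classExponent 11 3 a' ∧ 2 * classExponent 11 3 a' + 3 ≤ 11) ∧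
    (∀ a' < 4, Nat.Coprime a' 4 → 1 ≤ classExponent 11 4 a' ∧ 2 * classExponent 11 4 a' + 3 ≤ 11) ∧
    (∀ a' < 6, Nat.Coprime a' 6 → 1 ≤ classExponent 11 6 a' ∧ 2 * classExponent 11 6 a' + 3 ≤ 11) := by
  decide

/-- toy rung: `p = 23` (`e = 3, 4, 6` all divide 24, none divides 22). -/
example : (∀ a' < 3, Nat.Coprime a' 3 → 1 ≤ classExponent 23 3 a' ∧ 2 * classExponent 23 3 a' + 3 ≤ 23) ∧
    (∀ a' < 4, Nat.Coprime a' 4 → 1 ≤ classExponent 23 4 a' ∧ 2 * classExponent 23 4 a' + 3 ≤ 23) ∧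
    (∀ a' < 6, Nat.Coprime a' 6 → 1 ≤ classExponent 23 6 a' ∧ 2 * classExponent 23 6 a' + 3 ≤ 23) := by
  decide

/-- the two `p = 5` exceptions: `(5, e=6, a′=1)` = Kodaira II* has `a = 0` (weight-2 companion);
`(5, e=3, a′=2)` = Kodaira IV has `a = 2 = (p−1)/2` (companion on the QUADRATIC branch);
`(5,6,5)` = II and `(5,3,1)` = IV* have `a = 1` (weight-4 companion, central). -/
example : classExponent 5 6 1 = 0 ∧ classExponent 5 3 2 = 2 ∧
    classExponent 5 6 5 = 1 ∧ classExponent 5 3 1 = 1 := by decide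

/-- The anchor theorem's Steinberg-prime hypothesis (Fouquet–Wan Thm 1.13: `dim ρ̄^{I_ℓ} = 1`, `ρ̄^{G_ℓ} = 0`,
for `ρ̄ = E[p] ⊗ ω^a`) read on `E`: some multiplicative `ℓ` with `p ∤ v_ℓ(Δ_min)` (so `ρ̄` is ramified at `ℓ`)
and `a_ℓ(E) · ℓ^{a+1} ≢ 1 (mod p)`.  Wan 2016 Thm 1.4's variant asks instead `a_ℓ(E) = (−1)^{a+1}`. -/
def CentralCompanionAnchorLocus (W : WeierstrassCurve ℚ) [W.IsGloballyMinimal] (p a : ℕ) [Fact p.Prime] :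
    Prop :=
  ∃ (ℓ : ℕ) (_ : Fact ℓ.Prime), W.HasMultiplicativeReductionAtPrime ℓ ∧
    ¬ (p : ℤ) ∣ padicValInt ℓ W.minimalDiscriminantInt ∧
    ((W.frobeniusTrace ℓ : ZMod p) * (ℓ : ZMod p) ^ (a + 1) ≠ 1)

/-- Wan's sign variant of the locus. -/
def CentralCompanionAnchorLocusWan (W : WeierstrassCurve ℚ) [W.IsGloballyMinimal] (p a : ℕ) [Fact p.Prime] :
    Prop :=
  ∃ (ℓ : ℕ) (_ : Fact ℓ.Prime), W.HasMultiplicativeReductionAtPrime ℓ ∧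
    ¬ (p : ℤ) ∣ padicValInt ℓ W.minimalDiscriminantInt ∧ W.frobeniusTrace ℓ = (-1) ^ (a + 1)

end Summit.BirchSwinnertonDyer.BirchSwinnertonDyer.Cruxes.KolyvaginPrimitiveAdditive.CentralCompanionTransport
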